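import Literature.Analysis.FluidPDE.PeriodicBoundedMildTorus
import HarnessLib

/-!
# A periodic whole-space classical solution with constant cell mean descends to the torus

Analysis/FluidPDE support file (everything proved) for the perturbation step of M. P. Coiculescu,
S. Palasek, *Non-uniqueness of smooth solutions of the Navier–Stokes equations from critical data*,
Invent. Math. 244 (2025) = arXiv:2503.14699, §5 ¶1 ("`u⁽ⁱ⁾` is in fact smooth on `(0,1] × 𝕋³`"):
the regularity of `u = v + w` is obtained in the tree through the whole-space bounded mild theory
of Koch–Nadirashvili–Seregin–Šverák (`exists_classical_of_bounded_data`), which produces a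
*whole-space* classical solution with periodic velocity; this file descends such a solution to
the torus. It is the argument inside the tree's `Torus.exists_classicalNS_of_bounded_data`
(`PeriodicBoundedMildTorus.lean`), isolated as a lemma:

* `Torus.exists_isClassicalNSSolutionOn_of_periodic` — let `(v, p)` be a classical solution of
  the unforced Navier–Stokes equations (`ν = 1`) on `(a, b) × ℝᵈ` with every slice `v(t)` lattice
  periodic, and suppose the cell means `∫_{𝕋ᵈ} v(t)(repr x) dx` do not depend on `t ∈ (a, b)`.
  Then the descended velocity `V(t)(x) = v(t)(repr x)` is a classical solution on the torus on
  `(a, b)` for a suitable (periodic) pressure. Mechanism: `∇p` is periodic (momentum equation), so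
  `p = θ + ⟪c(t), ·⟫` with `θ` periodic; the descended system has the constant force `-c(t)`, and
  `d/dt ∫V = -c(t)` (all other terms are divergences) vanishes because the mean is constant.

## References

* J. C. Robinson, J. L. Rodrigo, W. Sadowski, *The three-dimensional Navier–Stokes equations*
  (CUP 2016), §1.8 and Thm. 6.8 with §7.2 (periodic setting, role of the mean). [folklore]
* G. Koch, N. Nadirashvili, G. Seregin, V. Šverák, Acta Math. 203 (2009) = arXiv:0709.3599, §4
  p. 8. [`KochNadirashviliSereginSverak2009`]
-/

noncomputable section

open MeasureTheory Set Function Filter TopologicalSpace InnerProductSpace Metric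
open Literature.Analysis.FunctionSpaces
open _root_.Topology
open scoped RealInnerProductSpace Laplacian ContDiff NNReal ENNReal

namespace Literature.Analysis.FluidPDE

variable {d : Type*} [Fintype d] [DecidableEq d]

/-- **A periodic whole-space classical solution with constant cell mean descends to the torus.**
Let `(v, p)` be a classical solution of the unforced Navier–Stokes equations (`ν = 1`) on
`(a, b) × ℝᵈ` with lattice-periodic velocity slices, and assume the cell means
`∫_{𝕋ᵈ} v(t)(repr x) dx` are independent of `t ∈ (a, b)`. Then `V(t)(x) = v(t)(repr x)` is a
classical solution on `𝕋ᵈ` on `(a, b)` with zero force, for some periodic pressure: the pressure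
gradient is periodic, `p = θ + ⟪c(t),·⟫` with periodic `θ`, the descended system carries the
constant force `-c(t)`, and `d/dt ∫ V = -c(t) = 0` by the constancy of the mean. (The argument of
the tree's `Torus.exists_classicalNS_of_bounded_data`, as a lemma.) [cite: KochNadirashviliSereginSverak2009, §4 p. 8 (arXiv:0709.3599v1)] -/
theorem Torus.exists_isClassicalNSSolutionOn_of_periodic {a b : ℝ}
    {v : ℝ → EuclideanSpace ℝ d → EuclideanSpace ℝ d} {p : ℝ → EuclideanSpace ℝ d → ℝ}
    (hcl : IsClassicalNSSolutionOn (Ioo a b) 1 0 v p) (hper : ∀ t, Torus.IsLatticePeriodic (v t))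
    {m : EuclideanSpace ℝ d}
    (hmean : ∀ t ∈ Ioo a b, ∫ x : UnitAddTorus d, v t (Torus.repr x) = m) :
    ∃ Θ : ℝ → UnitAddTorus d → ℝ,
      Torus.IsClassicalNSSolutionOn (Ioo a b) 1 0 (fun t x => v t (Torus.repr x)) Θ := by
  haveI : CompleteSpace (EuclideanSpace ℝ d) := FiniteDimensional.complete ℝ _
  have hSU : UniqueDiffOn ℝ (Ioo a b) := isOpen_Ioo.uniqueDiffOn
  have hperj : ∀ (j : d) (t : ℝ) (y : EuclideanSpace ℝ d),
      v t (y + EuclideanSpace.single j 1) = v t y := fun j t y => hper t j y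
  -- the torus velocity
  set V : ℝ → UnitAddTorus d → EuclideanSpace ℝ d := fun t x => v t (Torus.repr x) with hVdef
  have hVlift : ∀ t, Torus.lift (V t) = v t := fun t => Torus.lift_descend_holds (v t) (hper t)
  -- the pressure gradient is periodic
  have hmomR : ∀ t ∈ Ioo a b, ∀ y, gradient (p t) y =
      (1 : ℝ) • (Δ (v t)) y - timeDerivWithin (Ioo a b) v t y - convect (v t) (v t) y := by
    intro t ht y
    have h1 := hcl.momentum t ht y
    simp only [Pi.zero_apply, add_zero] at h1
    rw [sub_sub, h1, sub_sub_cancel]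
  have hgradper : ∀ t ∈ Ioo a b, ∀ (j : d) (y : EuclideanSpace ℝ d),
      gradient (p t) (y + EuclideanSpace.single j 1) = gradient (p t) y := by
    intro t ht j y
    have hfun : ∀ τ, (fun x => v τ (x + EuclideanSpace.single j 1)) = v τ :=
      fun τ => funext (hperj j τ)
    have h1 : (Δ (v t)) (y + EuclideanSpace.single j 1) = (Δ (v t)) y := by
      rw [← Torus.laplacian_comp_add_right (v t) (EuclideanSpace.single j 1) y, hfun t]
    have h2 : convect (v t) (v t) (y + EuclideanSpace.single j 1) = convect (v t) (v t) y := by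
      simp only [convect_apply]
      rw [hperj j t y, ← fderiv_comp_add_right (EuclideanSpace.single j (1 : ℝ)), hfun t]
    have h3 : timeDerivWithin (Ioo a b) v t (y + EuclideanSpace.single j 1) =
        timeDerivWithin (Ioo a b) v t y := by
      simp only [timeDerivWithin_apply]
      exact derivWithin_congr (fun τ _ => hperj j τ y) (hperj j t y)
    rw [hmomR t ht, hmomR t ht, h1, h2, h3]
  -- hence the periods of the pressure are constant in space
  have hpt_diff : ∀ t ∈ Ioo a b, Differentiable ℝ (p t) := fun t ht =>
    (hcl.smooth_pressure.contDiff_slice ht).differentiable (by simp)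
  have hcj : ∀ t ∈ Ioo a b, ∀ (j : d) (y : EuclideanSpace ℝ d),
      p t (y + EuclideanSpace.single j 1) - p t y = p t (EuclideanSpace.single j 1) - p t 0 := by
    intro t ht j y
    have hd1 : Differentiable ℝ fun x => p t (x + EuclideanSpace.single j 1) :=
      (hpt_diff t ht).comp (differentiable_id.add_const _)
    have hd : Differentiable ℝ fun x => p t (x + EuclideanSpace.single j 1) - p t x :=
      hd1.sub (hpt_diff t ht)
    have hzero : ∀ x, fderiv ℝ (fun x => p t (x + EuclideanSpace.single j 1) - p t x) x = 0 := by
      intro x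
      rw [fderiv_fun_sub (hd1 x) (hpt_diff t ht x), fderiv_comp_add_right, sub_eq_zero]
      have hg := hgradper t ht j x
      simp only [gradient] at hg
      exact (InnerProductSpace.toDual ℝ (EuclideanSpace ℝ d)).symm.injective hg
    have := is_const_of_fderiv_eq_zero hd hzero y 0
    simpa using this
  -- the linear part of the pressure and the periodic remainder
  set c : ℝ → d → ℝ := fun t j => p t (EuclideanSpace.single j 1) - p t 0 with hcdef
  set cv : ℝ → EuclideanSpace ℝ d := fun t => ∑ j, c t j • EuclideanSpace.single j (1 : ℝ)
    with hcvdef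
  have hcv_inner : ∀ (t : ℝ) (j : d), ⟪cv t, EuclideanSpace.single j 1⟫ = c t j := by
    intro t j
    have hon := (EuclideanSpace.basisFun d ℝ).orthonormal.inner_left_fintype (c t) j
    simpa [EuclideanSpace.basisFun_apply, hcvdef] using hon
  set θ : ℝ → EuclideanSpace ℝ d → ℝ := fun t y => p t y - ⟪cv t, y⟫ with hθdef
  have hθper : ∀ t ∈ Ioo a b, Torus.IsLatticePeriodic (θ t) := by
    intro t ht j y
    simp only [hθdef, inner_add_right, hcv_inner]
    have := hcj t ht j y
    linarith
  have hθgrad : ∀ t ∈ Ioo a b, ∀ y, gradient (θ t) y = gradient (p t) y - cv t := by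
    intro t ht y
    have hp' : HasFDerivAt (p t)
        (InnerProductSpace.toDual ℝ (EuclideanSpace ℝ d) (gradient (p t) y)) y :=
      (hpt_diff t ht y).hasGradientAt
    have hi' : HasFDerivAt (fun y : EuclideanSpace ℝ d => ⟪cv t, y⟫)
        (InnerProductSpace.toDual ℝ (EuclideanSpace ℝ d) (cv t)) y :=
      hasGradientAt_inner_const_left (cv t) y
    have hθ' : HasGradientAt (θ t) (gradient (p t) y - cv t) y := by
      rw [hasGradientAt_iff_hasFDerivAt, map_sub]
      exact hp'.sub hi'
    exact hθ'.gradient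
  -- smoothness of the new pressure and of the force
  have hcvs : ContDiffOn ℝ ∞ (fun q : ℝ × EuclideanSpace ℝ d => cv q.1) (Ioo a b ×ˢ univ) := by
    have hpj : ∀ z : EuclideanSpace ℝ d,
        ContDiffOn ℝ ∞ (fun q : ℝ × EuclideanSpace ℝ d => p q.1 z) (Ioo a b ×ˢ univ) := by
      intro z
      have hι : ContDiff ℝ ∞ (fun q : ℝ × EuclideanSpace ℝ d => ((q.1, z) : ℝ × EuclideanSpace ℝ d)) :=
        contDiff_fst.prodMk contDiff_const
      exact hcl.smooth_pressure.comp hι.contDiffOn fun q hq => ⟨(mem_prod.1 hq).1, mem_univ _⟩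
    simp only [hcvdef, hcdef]
    exact ContDiffOn.sum fun j _ => ((hpj _).sub (hpj _)).smul contDiffOn_const
  have hθs : IsSmoothSpaceTimeOn (Ioo a b) θ := by
    have h1 : ContDiffOn ℝ ∞ (fun q : ℝ × EuclideanSpace ℝ d => ⟪cv q.1, q.2⟫) (Ioo a b ×ˢ univ) :=
      hcvs.inner ℝ contDiffOn_snd
    exact hcl.smooth_pressure.sub h1
  -- the whole-space system with the constant force `-c(t)` and the periodic pressure `θ`
  have hR : IsClassicalNSSolutionOn (Ioo a b) 1 (fun (t : ℝ) (_ : EuclideanSpace ℝ d) => -cv t) v θ :=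
    { smooth_velocity := hcl.smooth_velocity
      smooth_pressure := hθs
      momentum := fun t ht y => by
        have h1 := hcl.momentum t ht y
        simp only [Pi.zero_apply, add_zero] at h1
        rw [h1, hθgrad t ht y]
        abel
      divFree := hcl.divFree }
  -- all data are periodic lifts: descend to the torus
  set Θ : ℝ → UnitAddTorus d → ℝ := fun t x => θ t (Torus.repr x) with hΘdef
  set fT : ℝ → UnitAddTorus d → EuclideanSpace ℝ d := fun t _ => -cv t with hfTdef
  have hΘlift : ∀ t ∈ Ioo a b, Torus.lift (Θ t) = θ t := fun t ht =>
    Torus.lift_descend_holds (θ t) (hθper t ht)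
  have hR' : IsClassicalNSSolutionOn (Ioo a b) 1 (fun t => Torus.lift (fT t))
      (fun t => Torus.lift (V t)) (fun t => Torus.lift (Θ t)) := by
    have h1 : IsClassicalNSSolutionOn (Ioo a b) 1 (fun t => Torus.lift (fT t)) v θ := hR
    exact (h1.congr_velocity fun t _ => hVlift t).congr_pressure hΘlift
  have hT : Torus.IsClassicalNSSolutionOn (Ioo a b) 1 fT V Θ :=
    IsClassicalNSSolutionOn.to_torus_holds hR'
  -- the mean does not move, so `c ≡ 0`
  have hc0 : ∀ t ∈ Ioo a b, cv t = 0 := by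
    intro t ht
    have hd := hT.hasDerivWithinAt_integral_velocity (convex_Ioo a b) ht
    have hconst : HasDerivWithinAt (fun s : ℝ => ∫ x, V s x) 0 (Ioo a b) t :=
      (hasDerivWithinAt_const t (Ioo a b) m).congr (fun s hs => hmean s hs) (hmean t ht)
    have heq := (hSU t ht).eq_deriv _ hd hconst
    have hint : ∫ x : UnitAddTorus d, fT t x = -cv t := by
      simp only [hfTdef, integral_const, probReal_univ, one_smul]
    rw [hint] at heq
    exact neg_eq_zero.1 heq
  -- the unforced torus system
  refine ⟨Θ, ?_⟩
  exact
    { smooth_velocity := hT.smooth_velocity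
      smooth_pressure := hT.smooth_pressure
      momentum := fun t ht x => by
        have h1 := hT.momentum t ht x
        simp only [hfTdef, hc0 t ht, neg_zero, add_zero] at h1
        simp only [Pi.zero_apply, add_zero]
        exact h1
      divFree := hT.divFree }

end Literature.Analysis.FluidPDE
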